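import Summits.NavierStokesRegularity.NavierStokesRegularity.Theorems.LerayQuarterDissipationFiniteDissipationLiouvilleTraceEpsilon
import HarnessLib

/-!
# Crux `FiniteDissipationLiouville` (stmt-NavierStokesRegularity-22144): ε-REGULARITY IN TERMS OF
# THE FINAL DATUM IN THE CRITICAL WEIGHTED SCALE `‖x‖⁻¹` — the `L^{3,∞}`-endpoint form of the
# one-scale trace criteria, with thresholds depending only on `(C, K)`

Theorems file of route `LerayQuarterDissipation` (lead prover g6; `--supports` the crux; portrait
facts for the one registered stub `stub_envelopeCriticalLiouville` of skeleton v9). Navier–Stokes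
regularity is NOT proved by anything here; no summit is.

`𝒟_{C,K}`: Type-I ancient mild fields `u` (`IsTypeIAncientMild C u`) with the quarter-rate law;
`T_u(ψ) = lim_{t→0⁻} ∫⟪u(t), ψ⟫` the distributional trace at the singular time (lead g3). The
one-scale criteria of `…TraceEpsilon` (lead g5) measure the trace in the dual-`L³` norm
`‖ψ‖_{L^{3/2}}`. The natural currency of the ENVELOPE class (`‖W(t,x)‖ ≤ A/(‖x‖ + √(−t))`, hence
`‖u₀(x)‖ ≤ A/‖x‖` for the final datum of a critical element, `…Envelope`/`…EnvelopeIff`) is instead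
the WEIGHTED `L¹` norm `∫ ‖ψ(x)‖/‖x‖ dx` — dual to the scale-critical weighted sup `‖ ‖x‖·u₀ ‖_∞`
(an `L^{3,∞}`-type quantity: `‖x‖⁻¹ ∉ L³_loc`, so the `L³` criteria say nothing about data of size
`θ/‖x‖`). It is invariant under the Navier–Stokes dilations exactly like the trace
(`∫ ‖ψ(λ⁻¹x)‖/‖x‖ dx = λ² ∫ ‖ψ‖/‖x‖`, `T_{u_λ}(ψ) = λ⁻² T_u(ψ(λ⁻¹·))`), so compactness across members
(ns-lqd-p1) makes the threshold uniform on the stratum: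

* `exists_trace_theta_apex` — **for all `C, K` there is `θ₁ = θ₁(C,K) > 0` such that every member
  `u ∈ 𝒟_{C,K}` whose trace satisfies `|T_u(ψ)| ≤ θ₁ ∫ ‖ψ(x)‖/‖x‖ dx` for all test fields `ψ`
  supported in ONE ball `B(0, ρ)` is regular at the apex.** For traces that are functions this is
  «`‖x‖·‖u₀(x)‖ ≤ θ₁` a.e. on one ball around the apex ⇒ regular» — the scale-invariant POINTWISE
  smallness criterion read off the final datum alone. Proof: rescale `ρ` to `1`; a sequence of
  singular members with thresholds `1/(k+1)` has a singular limit member (KNSS compactness +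
  persistence of the apex singularity, p591803) whose trace VANISHES on `B(0,1)` (trace continuity,
  lead g3); regular by `not_singular_of_trace_locallyBounded` (`…TraceApex`): contradiction.
* `exists_trace_theta_atInfinity` — the same OUTSIDE ONE BALL: `|T_u(ψ)| ≤ θ₂ ∫ ‖ψ‖/‖x‖` for all
  test fields supported in `{‖x‖ > R}` ⇒ regular (the singular limit member has trace vanishing
  outside `B̄(0,1)`: backward uniqueness from spatial infinity, `…TraceSupport`, lead g5).
* PORTRAIT (`trace_weighted_apex_floor_of_singular`, `trace_weighted_farField_floor_of_singular`):
  **the final datum `u₀` of a SINGULAR member of `𝒟_{C,K}` is NOT dominated by `θ₁/‖x‖` on any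
  ball around the apex, nor by `θ₂/‖x‖` outside any ball.** For the critical element of skeleton v9
  (envelope constant `A = A(C,K_c)`): `θ₁ ≤ "sup_{B(0,ρ)} ‖x‖‖u₀(x)‖" ≤ A` for every `ρ > 0` and
  `θ₂ ≤ "sup_{‖x‖>R} ‖x‖‖u₀(x)‖" ≤ A` for every `R` — the final datum saturates the critical
  `‖x‖⁻¹` scale, uniformly, at the apex AND at infinity (for a `λ`-DSS member the trace is discretely
  homogeneous, `u₀(x) = λu₀(λx)`, and the two floors are one statement about its log-periodic profile).
  HONEST FRAMING: `θ₁, θ₂` come from compactness, not explicit, and depend on `(C, K)`; no DSS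
  scenario of the catalogued wall is removed — a portrait fact in the envelope class's own currency.

References: Caffarelli–Kohn–Nirenberg, CPAM 35 (1982) (one-scale ε-regularity);
Koch–Nadirashvili–Seregin–Šverák, Acta Math. 203 (2009), §4 (the class, compactness);
Lemarié-Rieusset (2016), Thm. 15.4 (backward uniqueness used at infinity).
-/

noncomputable section

-- the summit and its single sub-problem share the name (CONVENTIONS §1), as in every Theorems file
set_option linter.dupNamespace false

namespace Summit.NavierStokesRegularity.NavierStokesRegularity.Theorems.FiniteDissipationLiouville.Birth.Apex

open MeasureTheory Set Filter Topology Metric Function TopologicalSpace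
open Literature.Analysis Literature.Analysis.FluidPDE
open scoped ENNReal NNReal RealInnerProductSpace

variable {C K : ℝ} {u : ℝ → EuclideanSpace ℝ (Fin 3) → EuclideanSpace ℝ (Fin 3)}

/-! ### Scale invariance of the weighted `L¹` norm and of the weighted smallness of the trace -/

/-- **The weighted `L¹` norm is critical**: `∫ ‖ψ(λ⁻¹ • x)‖/‖x‖ dx = λ² ∫ ‖ψ(x)‖/‖x‖ dx` for
`λ > 0` (substitution `x = λ • y` in `ℝ³`). -/
theorem integral_norm_div_norm_comp_inv_smul
    (ψ : EuclideanSpace ℝ (Fin 3) → EuclideanSpace ℝ (Fin 3)) {lam : ℝ} (hlam : 0 < lam) :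
    ∫ x, ‖ψ (lam⁻¹ • x)‖ / ‖x‖ = lam ^ 2 * ∫ x, ‖ψ x‖ / ‖x‖ := by
  have h := integral_comp_inv_smul_eq (g := fun x => ‖ψ x‖ / ‖x‖) hlam
  -- `‖ψ(λ⁻¹x)‖/‖λ⁻¹x‖ = λ (‖ψ(λ⁻¹x)‖/‖x‖)`
  have e : (fun x : EuclideanSpace ℝ (Fin 3) => ‖ψ (lam⁻¹ • x)‖ / ‖lam⁻¹ • x‖) =
      fun x => lam * (‖ψ (lam⁻¹ • x)‖ / ‖x‖) := by
    funext x
    rw [norm_smul, norm_inv, Real.norm_of_nonneg hlam.le]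
    by_cases hx : ‖x‖ = 0
    · simp [hx]
    · field_simp
  simp only [e, integral_const_mul] at h
  have hl : lam ≠ 0 := hlam.ne'
  calc ∫ x, ‖ψ (lam⁻¹ • x)‖ / ‖x‖
      = lam⁻¹ * (lam * ∫ x, ‖ψ (lam⁻¹ • x)‖ / ‖x‖) := by field_simp
    _ = lam⁻¹ * (lam ^ 3 * ∫ x, ‖ψ x‖ / ‖x‖) := by rw [h]
    _ = lam ^ 2 * ∫ x, ‖ψ x‖ / ‖x‖ := by field_simp

/-- **The weighted smallness of the trace on a ball is dilation invariant (normalisation to the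
unit ball).** If `|T_u(ψ)| ≤ θ ∫ ‖ψ‖/‖x‖` for the test fields supported in `B(0, ρ)`, then the
dilate `u_ρ = nsRescale ρ u` satisfies the same with `B(0, 1)`. -/
theorem trace_weightedSmall_ball_nsRescale (hu : IsTypeIAncientMild C u)
    (hlaw : ∀ s : ℝ, s < 0 → ∫⁻ x, ‖fderiv ℝ (u s) x‖ₑ ^ 2 ≤ ENNReal.ofReal (K / Real.sqrt (-s)))
    {ρ θ : ℝ} (hρ : 0 < ρ)
    (hsmall : ∀ ψ : EuclideanSpace ℝ (Fin 3) → EuclideanSpace ℝ (Fin 3),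
      FunctionSpaces.IsTestFunctionOn (⊤ : Opens (EuclideanSpace ℝ (Fin 3))) ψ →
      (∀ x, ψ x ≠ 0 → ‖x‖ < ρ) →
      ∀ T : ℝ, Tendsto (fun t => ∫ x, ⟪u t x, ψ x⟫) (𝓝[<] 0) (𝓝 T) →
        |T| ≤ θ * ∫ x, ‖ψ x‖ / ‖x‖) :
    ∀ ψ : EuclideanSpace ℝ (Fin 3) → EuclideanSpace ℝ (Fin 3),
      FunctionSpaces.IsTestFunctionOn (⊤ : Opens (EuclideanSpace ℝ (Fin 3))) ψ →
      (∀ x, ψ x ≠ 0 → ‖x‖ < 1) →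
      ∀ T : ℝ, Tendsto (fun t => ∫ x, ⟪nsRescale ρ u t x, ψ x⟫) (𝓝[<] 0) (𝓝 T) →
        |T| ≤ θ * ∫ x, ‖ψ x‖ / ‖x‖ := by
  intro ψ hψ hsupp T hT
  -- the trace of `u` against the dilated field, and the identification `T = ρ⁻² T'`
  obtain ⟨T', hT'⟩ := exists_tendsto_pairing_finalSlice hu hlaw
    (hψ.comp_smul_top (inv_ne_zero hρ.ne'))
  have hTv := tendsto_pairing_nsRescale (w := u) hρ hT'
  have hTeq : T = (ρ ^ 2)⁻¹ * T' := tendsto_nhds_unique hT hTv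
  -- the smallness for the dilated field (supported in `B(0, ρ)`)
  have hsupp' : ∀ x, ψ (ρ⁻¹ • x) ≠ 0 → ‖x‖ < ρ := fun x hx => by
    have h := support_comp_inv_smul hρ hsupp x hx
    rwa [mul_one] at h
  have h := hsmall _ (hψ.comp_smul_top (inv_ne_zero hρ.ne')) hsupp' T' hT'
  rw [integral_norm_div_norm_comp_inv_smul ψ hρ] at h
  have hρ2 : 0 < ρ ^ 2 := by positivity
  rw [hTeq, abs_mul, abs_of_pos (inv_pos.2 hρ2)]
  calc (ρ ^ 2)⁻¹ * |T'| ≤ (ρ ^ 2)⁻¹ * (θ * (ρ ^ 2 * ∫ x, ‖ψ x‖ / ‖x‖)) :=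
        mul_le_mul_of_nonneg_left h (inv_nonneg.2 hρ2.le)
    _ = θ * ∫ x, ‖ψ x‖ / ‖x‖ := by field_simp

/-- **The weighted smallness of the trace outside a ball is dilation invariant (normalisation to
the unit ball).** If `|T_u(ψ)| ≤ θ ∫ ‖ψ‖/‖x‖` for the test fields supported in `{‖x‖ > R}`, then
`u_R = nsRescale R u` satisfies the same with `{‖x‖ > 1}`. -/
theorem trace_weightedSmall_farField_nsRescale (hu : IsTypeIAncientMild C u)
    (hlaw : ∀ s : ℝ, s < 0 → ∫⁻ x, ‖fderiv ℝ (u s) x‖ₑ ^ 2 ≤ ENNReal.ofReal (K / Real.sqrt (-s)))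
    {R θ : ℝ} (hR : 0 < R)
    (hsmall : ∀ ψ : EuclideanSpace ℝ (Fin 3) → EuclideanSpace ℝ (Fin 3),
      FunctionSpaces.IsTestFunctionOn (⊤ : Opens (EuclideanSpace ℝ (Fin 3))) ψ →
      (∀ x, ψ x ≠ 0 → R < ‖x‖) →
      ∀ T : ℝ, Tendsto (fun t => ∫ x, ⟪u t x, ψ x⟫) (𝓝[<] 0) (𝓝 T) →
        |T| ≤ θ * ∫ x, ‖ψ x‖ / ‖x‖) :
    ∀ ψ : EuclideanSpace ℝ (Fin 3) → EuclideanSpace ℝ (Fin 3),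
      FunctionSpaces.IsTestFunctionOn (⊤ : Opens (EuclideanSpace ℝ (Fin 3))) ψ →
      (∀ x, ψ x ≠ 0 → 1 < ‖x‖) →
      ∀ T : ℝ, Tendsto (fun t => ∫ x, ⟪nsRescale R u t x, ψ x⟫) (𝓝[<] 0) (𝓝 T) →
        |T| ≤ θ * ∫ x, ‖ψ x‖ / ‖x‖ := by
  intro ψ hψ hsupp T hT
  obtain ⟨T', hT'⟩ := exists_tendsto_pairing_finalSlice hu hlaw
    (hψ.comp_smul_top (inv_ne_zero hR.ne'))
  have hTv := tendsto_pairing_nsRescale (w := u) hR hT'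
  have hTeq : T = (R ^ 2)⁻¹ * T' := tendsto_nhds_unique hT hTv
  -- the dilated field is supported in `{‖x‖ > R}`
  have hsupp' : ∀ x, ψ (R⁻¹ • x) ≠ 0 → R < ‖x‖ := fun x hx => by
    have h := hsupp _ hx
    rw [norm_smul, norm_inv, Real.norm_of_nonneg hR.le] at h
    rwa [lt_inv_mul_iff₀ hR, mul_one] at h
  have h := hsmall _ (hψ.comp_smul_top (inv_ne_zero hR.ne')) hsupp' T' hT'
  rw [integral_norm_div_norm_comp_inv_smul ψ hR] at h
  have hR2 : 0 < R ^ 2 := by positivity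
  rw [hTeq, abs_mul, abs_of_pos (inv_pos.2 hR2)]
  calc (R ^ 2)⁻¹ * |T'| ≤ (R ^ 2)⁻¹ * (θ * (R ^ 2 * ∫ x, ‖ψ x‖ / ‖x‖)) :=
        mul_le_mul_of_nonneg_left h (inv_nonneg.2 hR2.le)
    _ = θ * ∫ x, ‖ψ x‖ / ‖x‖ := by field_simp

/-! ### One-scale weighted ε-regularity at the final time, uniform threshold -/

/-- **ONE-SCALE ε-REGULARITY IN THE CRITICAL WEIGHTED SCALE, threshold depending on `(C, K)`
only.** For all `C, K` there is `θ₁ > 0` such that: if `u ∈ 𝒟_{C,K}` and, for SOME `ρ > 0`, every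
test field `ψ` supported in `B(0, ρ)` has trace value `|T_u(ψ)| ≤ θ₁ ∫ ‖ψ(x)‖/‖x‖ dx` (for a trace
that is a function: `‖x‖·‖u₀(x)‖ ≤ θ₁` a.e. on `B(0, ρ)`), then `u` is NOT singular at the apex. -/
theorem exists_trace_theta_apex (C K : ℝ) : ∃ θ₁ > 0,
    ∀ (u : ℝ → EuclideanSpace ℝ (Fin 3) → EuclideanSpace ℝ (Fin 3)),
      IsTypeIAncientMild C u →
      (∀ s : ℝ, s < 0 → ∫⁻ x, ‖fderiv ℝ (u s) x‖ₑ ^ 2 ≤ ENNReal.ofReal (K / Real.sqrt (-s))) →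
      ∀ ρ > 0,
      (∀ ψ : EuclideanSpace ℝ (Fin 3) → EuclideanSpace ℝ (Fin 3),
        FunctionSpaces.IsTestFunctionOn (⊤ : Opens (EuclideanSpace ℝ (Fin 3))) ψ →
        (∀ x, ψ x ≠ 0 → ‖x‖ < ρ) →
        ∀ T : ℝ, Tendsto (fun t => ∫ x, ⟪u t x, ψ x⟫) (𝓝[<] 0) (𝓝 T) →
          |T| ≤ θ₁ * ∫ x, ‖ψ x‖ / ‖x‖) →
      ¬ (∀ r > 0, ∀ M : ℝ, ∃ t ∈ Set.Ioo (-(r ^ 2)) (0 : ℝ),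
          ∃ x ∈ Metric.ball (0 : EuclideanSpace ℝ (Fin 3)) r, M < ‖u t x‖) := by
  by_contra hcon
  push Not at hcon
  -- ### a sequence of singular members, weighted-small at one scale with threshold `1/(k+1)`
  have hseq : ∀ k : ℕ, ∃ (v : ℝ → EuclideanSpace ℝ (Fin 3) → EuclideanSpace ℝ (Fin 3)),
      IsTypeIAncientMild C v ∧
      (∀ s : ℝ, s < 0 → ∫⁻ x, ‖fderiv ℝ (v s) x‖ₑ ^ 2 ≤ ENNReal.ofReal (K / Real.sqrt (-s))) ∧
      (∀ ψ : EuclideanSpace ℝ (Fin 3) → EuclideanSpace ℝ (Fin 3),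
        FunctionSpaces.IsTestFunctionOn (⊤ : Opens (EuclideanSpace ℝ (Fin 3))) ψ →
        (∀ x, ψ x ≠ 0 → ‖x‖ < 1) →
        ∀ T : ℝ, Tendsto (fun t => ∫ x, ⟪v t x, ψ x⟫) (𝓝[<] 0) (𝓝 T) →
          |T| ≤ 1 / ((k : ℝ) + 1) * ∫ x, ‖ψ x‖ / ‖x‖) ∧
      (∀ r > 0, ∀ M : ℝ, ∃ t ∈ Set.Ioo (-(r ^ 2)) (0 : ℝ),
          ∃ x ∈ Metric.ball (0 : EuclideanSpace ℝ (Fin 3)) r, M < ‖v t x‖) := by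
    intro k
    obtain ⟨u, hu, hlaw, ρ, hρ, hsmall, hsing⟩ := hcon (1 / ((k : ℝ) + 1)) (by positivity)
    exact ⟨nsRescale ρ u, hu.nsRescale hρ, RecurrentReductionD.dissipationLaw_nsRescale hlaw hρ,
      trace_weightedSmall_ball_nsRescale hu hlaw hρ hsmall,
      RecurrentReductionD.singularAtOrigin_nsRescale hsing hρ⟩
  choose v hv hvlaw hvsmall hvsing using hseq
  -- ### KNSS compactness across members: a singular limit member `W ∈ 𝒟_{C,K}`
  obtain ⟨ψs, hψs, W, hW, hunif, hpt, hgrad⟩ := Compactness.seqLimit hv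
  have hψt : Tendsto ψs atTop atTop := hψs.tendsto_atTop
  have hWlaw : ∀ s : ℝ, s < 0 →
      ∫⁻ x, ‖fderiv ℝ (W s) x‖ₑ ^ 2 ≤ ENNReal.ofReal (K / Real.sqrt (-s)) :=
    Compactness.law_of_seqLimit (Kinf := K) (Kk := fun _ => K) hψt hvlaw
      (fun ε hε => Eventually.of_forall fun _ => by linarith) hgrad
  have hWsing := Compactness.persistent_singularity_seq (w := fun j => v (ψs j))
    (fun j => hv (ψs j)) (fun j => hvlaw (ψs j)) (fun j => hvsing (ψs j)) hW hunif
  -- ### the trace of `W` vanishes on `B(0, 1)`: it is "bounded by `0`" there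
  refine not_singular_of_trace_locallyBounded hW hWlaw one_pos (M := 0) (fun φ hφ hsupp L hL => ?_)
    hWsing
  rw [zero_mul]
  -- trace values of the approximants against `φ`
  have hex : ∀ j, ∃ Tj : ℝ, Tendsto (fun t => ∫ x, ⟪v (ψs j) t x, φ x⟫) (𝓝[<] 0) (𝓝 Tj) :=
    fun j => exists_tendsto_pairing_finalSlice (hv (ψs j)) (hvlaw (ψs j)) hφ
  choose Tj hTj using hex
  have hconv : Tendsto Tj atTop (𝓝 L) :=
    tendsto_trace_of_tendsto_slices hφ (fun j => hv (ψs j)) (fun j => hvlaw (ψs j)) hW hWlaw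
      (fun t ht x => hpt t ht x) hTj hL
  set I : ℝ := ∫ x, ‖φ x‖ / ‖x‖ with hI
  have hbound : ∀ j, |Tj j| ≤ 1 / ((ψs j : ℝ) + 1) * I := fun j =>
    hvsmall (ψs j) φ hφ hsupp (Tj j) (hTj j)
  have hzero : Tendsto Tj atTop (𝓝 0) := by
    have hmaj : Tendsto (fun j => 1 / ((ψs j : ℝ) + 1) * I) atTop (𝓝 0) := by
      have h1 : Tendsto (fun j => 1 / ((ψs j : ℝ) + 1)) atTop (𝓝 0) := by
        have h2 : Tendsto (fun j => (ψs j : ℝ) + 1) atTop atTop :=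
          tendsto_atTop_add_const_right _ _ (tendsto_natCast_atTop_atTop.comp hψt)
        exact tendsto_const_nhds.div_atTop h2
      simpa using h1.mul_const I
    exact squeeze_zero_norm (fun j => by rw [Real.norm_eq_abs]; exact hbound j) hmaj
  have hL0 : L = 0 := tendsto_nhds_unique hconv hzero
  rw [hL0, abs_zero]

/-- **ONE-SCALE WEIGHTED ε-REGULARITY FROM SPATIAL INFINITY, threshold depending on `(C, K)`
only.** For all `C, K` there is `θ₂ > 0` such that: if `u ∈ 𝒟_{C,K}` and, for SOME `R > 0`, every
test field `ψ` supported in `{‖x‖ > R}` has trace value `|T_u(ψ)| ≤ θ₂ ∫ ‖ψ(x)‖/‖x‖ dx` (for a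
trace that is a function: `‖x‖·‖u₀(x)‖ ≤ θ₂` a.e. outside `B(0,R)`), then `u` is NOT singular at the
apex. The singular limit produced by compactness has a trace vanishing outside the unit ball,
which backward uniqueness from spatial infinity (`…TraceSupport`) forbids. -/
theorem exists_trace_theta_atInfinity (C K : ℝ) : ∃ θ₂ > 0,
    ∀ (u : ℝ → EuclideanSpace ℝ (Fin 3) → EuclideanSpace ℝ (Fin 3)),
      IsTypeIAncientMild C u →
      (∀ s : ℝ, s < 0 → ∫⁻ x, ‖fderiv ℝ (u s) x‖ₑ ^ 2 ≤ ENNReal.ofReal (K / Real.sqrt (-s))) →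
      ∀ R > 0,
      (∀ ψ : EuclideanSpace ℝ (Fin 3) → EuclideanSpace ℝ (Fin 3),
        FunctionSpaces.IsTestFunctionOn (⊤ : Opens (EuclideanSpace ℝ (Fin 3))) ψ →
        (∀ x, ψ x ≠ 0 → R < ‖x‖) →
        ∀ T : ℝ, Tendsto (fun t => ∫ x, ⟪u t x, ψ x⟫) (𝓝[<] 0) (𝓝 T) →
          |T| ≤ θ₂ * ∫ x, ‖ψ x‖ / ‖x‖) →
      ¬ (∀ r > 0, ∀ M : ℝ, ∃ t ∈ Set.Ioo (-(r ^ 2)) (0 : ℝ),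
          ∃ x ∈ Metric.ball (0 : EuclideanSpace ℝ (Fin 3)) r, M < ‖u t x‖) := by
  by_contra hcon
  push Not at hcon
  have hseq : ∀ k : ℕ, ∃ (v : ℝ → EuclideanSpace ℝ (Fin 3) → EuclideanSpace ℝ (Fin 3)),
      IsTypeIAncientMild C v ∧
      (∀ s : ℝ, s < 0 → ∫⁻ x, ‖fderiv ℝ (v s) x‖ₑ ^ 2 ≤ ENNReal.ofReal (K / Real.sqrt (-s))) ∧
      (∀ ψ : EuclideanSpace ℝ (Fin 3) → EuclideanSpace ℝ (Fin 3),
        FunctionSpaces.IsTestFunctionOn (⊤ : Opens (EuclideanSpace ℝ (Fin 3))) ψ →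
        (∀ x, ψ x ≠ 0 → 1 < ‖x‖) →
        ∀ T : ℝ, Tendsto (fun t => ∫ x, ⟪v t x, ψ x⟫) (𝓝[<] 0) (𝓝 T) →
          |T| ≤ 1 / ((k : ℝ) + 1) * ∫ x, ‖ψ x‖ / ‖x‖) ∧
      (∀ r > 0, ∀ M : ℝ, ∃ t ∈ Set.Ioo (-(r ^ 2)) (0 : ℝ),
          ∃ x ∈ Metric.ball (0 : EuclideanSpace ℝ (Fin 3)) r, M < ‖v t x‖) := by
    intro k
    obtain ⟨u, hu, hlaw, R, hR, hsmall, hsing⟩ := hcon (1 / ((k : ℝ) + 1)) (by positivity)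
    exact ⟨nsRescale R u, hu.nsRescale hR, RecurrentReductionD.dissipationLaw_nsRescale hlaw hR,
      trace_weightedSmall_farField_nsRescale hu hlaw hR hsmall,
      RecurrentReductionD.singularAtOrigin_nsRescale hsing hR⟩
  choose v hv hvlaw hvsmall hvsing using hseq
  obtain ⟨ψs, hψs, W, hW, hunif, hpt, hgrad⟩ := Compactness.seqLimit hv
  have hψt : Tendsto ψs atTop atTop := hψs.tendsto_atTop
  have hWlaw : ∀ s : ℝ, s < 0 →
      ∫⁻ x, ‖fderiv ℝ (W s) x‖ₑ ^ 2 ≤ ENNReal.ofReal (K / Real.sqrt (-s)) :=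
    Compactness.law_of_seqLimit (Kinf := K) (Kk := fun _ => K) hψt hvlaw
      (fun ε hε => Eventually.of_forall fun _ => by linarith) hgrad
  have hWsing := Compactness.persistent_singularity_seq (w := fun j => v (ψs j))
    (fun j => hv (ψs j)) (fun j => hvlaw (ψs j)) (fun j => hvsing (ψs j)) hW hunif
  -- ### the trace of `W` vanishes outside `B̄(0, 1)`: backward uniqueness from infinity
  refine notSingular_of_trace_farField_vanishing hW hWlaw (R₁ := 1) (fun φ hφ hsupp => ?_) hWsing
  obtain ⟨L, hL⟩ := exists_tendsto_pairing_finalSlice hW hWlaw hφ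
  suffices hL0 : L = 0 by rwa [hL0] at hL
  have hex : ∀ j, ∃ Tj : ℝ, Tendsto (fun t => ∫ x, ⟪v (ψs j) t x, φ x⟫) (𝓝[<] 0) (𝓝 Tj) :=
    fun j => exists_tendsto_pairing_finalSlice (hv (ψs j)) (hvlaw (ψs j)) hφ
  choose Tj hTj using hex
  have hconv : Tendsto Tj atTop (𝓝 L) :=
    tendsto_trace_of_tendsto_slices hφ (fun j => hv (ψs j)) (fun j => hvlaw (ψs j)) hW hWlaw
      (fun t ht x => hpt t ht x) hTj hL
  set I : ℝ := ∫ x, ‖φ x‖ / ‖x‖ with hI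
  have hbound : ∀ j, |Tj j| ≤ 1 / ((ψs j : ℝ) + 1) * I := fun j =>
    hvsmall (ψs j) φ hφ hsupp (Tj j) (hTj j)
  have hzero : Tendsto Tj atTop (𝓝 0) := by
    have hmaj : Tendsto (fun j => 1 / ((ψs j : ℝ) + 1) * I) atTop (𝓝 0) := by
      have h1 : Tendsto (fun j => 1 / ((ψs j : ℝ) + 1)) atTop (𝓝 0) := by
        have h2 : Tendsto (fun j => (ψs j : ℝ) + 1) atTop atTop :=
          tendsto_atTop_add_const_right _ _ (tendsto_natCast_atTop_atTop.comp hψt)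
        exact tendsto_const_nhds.div_atTop h2
      simpa using h1.mul_const I
    exact squeeze_zero_norm (fun j => by rw [Real.norm_eq_abs]; exact hbound j) hmaj
  exact tendsto_nhds_unique hconv hzero

/-! ### Portrait: uniform weighted floors of the final datum of a singular member -/

/-- **PORTRAIT ENTRY (stub `stub_envelopeCriticalLiouville`): uniform weighted floor at the apex.**
There is `θ₁ = θ₁(C,K) > 0` such that the final datum of every SINGULAR member of `𝒟_{C,K}` has,
in EVERY ball `B(0, ρ)`, a test field `ψ` with `|T_u(ψ)| > θ₁ ∫ ‖ψ‖/‖x‖` — the datum is nowhere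
near the apex dominated by `θ₁/‖x‖`. -/
theorem trace_weighted_apex_floor_of_singular (C K : ℝ) : ∃ θ₁ > 0,
    ∀ (u : ℝ → EuclideanSpace ℝ (Fin 3) → EuclideanSpace ℝ (Fin 3)),
      IsTypeIAncientMild C u →
      (∀ s : ℝ, s < 0 → ∫⁻ x, ‖fderiv ℝ (u s) x‖ₑ ^ 2 ≤ ENNReal.ofReal (K / Real.sqrt (-s))) →
      (∀ r > 0, ∀ M : ℝ, ∃ t ∈ Set.Ioo (-(r ^ 2)) (0 : ℝ),
          ∃ x ∈ Metric.ball (0 : EuclideanSpace ℝ (Fin 3)) r, M < ‖u t x‖) →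
      ∀ ρ > 0, ∃ (ψ : EuclideanSpace ℝ (Fin 3) → EuclideanSpace ℝ (Fin 3)) (T : ℝ),
        FunctionSpaces.IsTestFunctionOn (⊤ : Opens (EuclideanSpace ℝ (Fin 3))) ψ ∧
          (∀ x, ψ x ≠ 0 → ‖x‖ < ρ) ∧
          Tendsto (fun t => ∫ x, ⟪u t x, ψ x⟫) (𝓝[<] 0) (𝓝 T) ∧
          θ₁ * (∫ x, ‖ψ x‖ / ‖x‖) < |T| := by
  obtain ⟨θ₁, hθ₁, h⟩ := exists_trace_theta_apex C K
  refine ⟨θ₁, hθ₁, fun u hu hlaw hsing ρ hρ => ?_⟩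
  by_contra hno
  push Not at hno
  exact h u hu hlaw ρ hρ (fun ψ hψ hs T hT => hno ψ T hψ hs hT) hsing

/-- **PORTRAIT ENTRY (stub `stub_envelopeCriticalLiouville`): uniform weighted floor at infinity.**
There is `θ₂ = θ₂(C,K) > 0` such that the final datum of every SINGULAR member of `𝒟_{C,K}` has,
outside EVERY ball `B(0, R)`, a test field `ψ` with `|T_u(ψ)| > θ₂ ∫ ‖ψ‖/‖x‖` — the datum is nowhere
near spatial infinity dominated by `θ₂/‖x‖`. -/
theorem trace_weighted_farField_floor_of_singular (C K : ℝ) : ∃ θ₂ > 0,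
    ∀ (u : ℝ → EuclideanSpace ℝ (Fin 3) → EuclideanSpace ℝ (Fin 3)),
      IsTypeIAncientMild C u →
      (∀ s : ℝ, s < 0 → ∫⁻ x, ‖fderiv ℝ (u s) x‖ₑ ^ 2 ≤ ENNReal.ofReal (K / Real.sqrt (-s))) →
      (∀ r > 0, ∀ M : ℝ, ∃ t ∈ Set.Ioo (-(r ^ 2)) (0 : ℝ),
          ∃ x ∈ Metric.ball (0 : EuclideanSpace ℝ (Fin 3)) r, M < ‖u t x‖) →
      ∀ R > 0, ∃ (ψ : EuclideanSpace ℝ (Fin 3) → EuclideanSpace ℝ (Fin 3)) (T : ℝ),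
        FunctionSpaces.IsTestFunctionOn (⊤ : Opens (EuclideanSpace ℝ (Fin 3))) ψ ∧
          (∀ x, ψ x ≠ 0 → R < ‖x‖) ∧
          Tendsto (fun t => ∫ x, ⟪u t x, ψ x⟫) (𝓝[<] 0) (𝓝 T) ∧
          θ₂ * (∫ x, ‖ψ x‖ / ‖x‖) < |T| := by
  obtain ⟨θ₂, hθ₂, h⟩ := exists_trace_theta_atInfinity C K
  refine ⟨θ₂, hθ₂, fun u hu hlaw hsing R hR => ?_⟩
  by_contra hno
  push Not at hno
  exact h u hu hlaw R hR (fun ψ hψ hs T hT => hno ψ T hψ hs hT) hsing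

/-- **The crux ⟺ its restriction to members whose final datum saturates the critical weighted
scale at the apex AND at infinity** (both floors hold on every singular member). -/
theorem finiteDissipationLiouville_iff_weightedFloors :
    Summit.NavierStokesRegularity.NavierStokesRegularity.Theses.LerayQuarterDissipation.FiniteDissipationLiouville ↔
      ∀ (C K : ℝ) (u : ℝ → EuclideanSpace ℝ (Fin 3) → EuclideanSpace ℝ (Fin 3)),
        IsTypeIAncientMild C u →
        (∀ s : ℝ, s < 0 → ∫⁻ x, ‖fderiv ℝ (u s) x‖ₑ ^ 2 ≤ ENNReal.ofReal (K / Real.sqrt (-s))) →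
        -- the apex floor: in every ball some test field beats `θ/‖x‖` for every `θ` below `θ₁`
        (∃ θ > 0, ∀ ρ > 0, ∃ (ψ : EuclideanSpace ℝ (Fin 3) → EuclideanSpace ℝ (Fin 3)) (T : ℝ),
          FunctionSpaces.IsTestFunctionOn (⊤ : Opens (EuclideanSpace ℝ (Fin 3))) ψ ∧
            (∀ x, ψ x ≠ 0 → ‖x‖ < ρ) ∧
            Tendsto (fun t => ∫ x, ⟪u t x, ψ x⟫) (𝓝[<] 0) (𝓝 T) ∧
            θ * (∫ x, ‖ψ x‖ / ‖x‖) < |T|) →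
        -- the far-field floor
        (∃ θ > 0, ∀ R > 0, ∃ (ψ : EuclideanSpace ℝ (Fin 3) → EuclideanSpace ℝ (Fin 3)) (T : ℝ),
          FunctionSpaces.IsTestFunctionOn (⊤ : Opens (EuclideanSpace ℝ (Fin 3))) ψ ∧
            (∀ x, ψ x ≠ 0 → R < ‖x‖) ∧
            Tendsto (fun t => ∫ x, ⟪u t x, ψ x⟫) (𝓝[<] 0) (𝓝 T) ∧
            θ * (∫ x, ‖ψ x‖ / ‖x‖) < |T|) →
        ¬ (∀ r > 0, ∀ M : ℝ, ∃ t ∈ Set.Ioo (-(r ^ 2)) (0 : ℝ),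
            ∃ x ∈ Metric.ball (0 : EuclideanSpace ℝ (Fin 3)) r, M < ‖u t x‖) := by
  unfold Summit.NavierStokesRegularity.NavierStokesRegularity.Theses.LerayQuarterDissipation.FiniteDissipationLiouville
  constructor
  · intro h C K u hu hlaw _ _
    exact h C K u hu hlaw
  · intro h C K u hu hlaw hsing
    obtain ⟨θ₁, hθ₁, h₁⟩ := trace_weighted_apex_floor_of_singular C K
    obtain ⟨θ₂, hθ₂, h₂⟩ := trace_weighted_farField_floor_of_singular C K
    exact h C K u hu hlaw ⟨θ₁, hθ₁, h₁ u hu hlaw hsing⟩ ⟨θ₂, hθ₂, h₂ u hu hlaw hsing⟩ hsing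

end Summit.NavierStokesRegularity.NavierStokesRegularity.Theorems.FiniteDissipationLiouville.Birth.Apex

end
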